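import Summits.CriticalPhenomena.PercolationContinuityZ3.Theorems.PercNearOneGluingNoHeavyLowerTailSahiCTCRtThreeWindowFourCheck
import Summits.CriticalPhenomena.PercolationContinuityZ3.Theorems.PercNearOneGluingNoHeavyLowerTailSahiCTCRtThreeCertNine
import HarnessLib

/-!
# `NoHeavyLowerTail` (crux stmt-CriticalPhenomena-4575), P3 lane: **ROW 0 OF `R_3 ∈ ℕ[s]` FOR EVERY NUMBER OF POINTS**

Support file (seat `prim-l12-p3`, gen 51; `--supports stmt-CriticalPhenomena-4575`; `--computational` only through the import of
`…RtThreeWindowFourCheck`, whose `checkPair_of_mem` contains the `native_decide` enumeration `checkAll = true`).  Memo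
`run/shared/lean/prim/prim-l12/FROM-prim-l12-p3-g51-ROW0-ALL-K-LEAN.md`.

**THEOREM `coeff_ind_Rt_three_nonneg`.**  For up-sets `𝒳, 𝒵 ⊆ 2^α` and a finset `V` with `∅ ∉ 𝒳, 𝒵` and no singleton `{v}`, `v ∈ V`, in `𝒳` or `𝒵`
(the single points loop-free), the squarefree coefficient `[s^V] R_3(𝒳,𝒵)` of the level-3 threshold form
`R_3 = Θ₂·(Π·Y₃ − X·Z) + Π·X₂·Z₂` (`…SahiCTCRtForm.Rt 3`) is `≥ 0` — for EVERY `#V` (the tree had `#V ≤ 9`, `…RtThreeCertNine`).  Profile forms: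
`coeff_Rt_three_nonneg_of_le_one` (entries `≤ 1`; a family containing `∅` is `2^α` and then `R_3 = 0`, `Rt_three_univ_powerset_left/right`) and
`coeff_Rt_three_nonneg_of_card_dbl_eq_zero` = literally the `#dbl n = 0` case of the open core `hLF` of
`…RtThreeDiagonalBase.coeff_Rt_three_nonneg_of_loopFree'` (`R_3 ∈ ℕ[s]` ⟸ the loop-free rows with `#dbl ≤ 2`; rows `#dbl = 1, 2` remain).
PROOF.  `#V ≤ 9`: `coeff_ind_Rt_three_nonneg_of_card_le_nine`.  `#V = k ≥ 10`: `…RtThreeLocalWindow.coeff_ind_Rt_three_nonneg_of_local` (pivotal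
Kleitman bulk `≥ 0` + localisation of the window atoms and of the small pairs onto the 4-subsets `Q ⊆ V`) asks for a local inequality on every
`Q`; `exists_map_univ_eq` writes `Q = univ.map φ` (`φ : Fin 4 ↪ α`), `…RtThreeTransport.atomSum_map` and `localPairs_map_div` move the local quantity
to the pulled-back families on `Fin 4`, which are loop-free up-sets (`pullback_mem_ups`), and `…RtThreeWindowFourCheck.loc_nonneg_fin4` is the
kernel-checked four-point certificate (fifteen moments, fifteen weight polynomials, `12 996` pairs).  No new definitions; nothing is asserted
about the crux.
-/

noncomputable section

namespace Summit.CriticalPhenomena.PercolationContinuityZ3.Theorems.SahiCTCForms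

open Finset

/-! ## Part ROW: transport to `Fin 4` and ROW 0 for every number of points -/

namespace RtThreeFin4

open SahiCTCGenFun

/-- A 4-subset is the image of `univ : Finset (Fin 4)` under an injection. [folklore] -/
theorem exists_map_univ_eq {α : Type*} [DecidableEq α] (Q : Finset α) (hQ : #Q = 4) :
    ∃ φ : Fin 4 ↪ α, (univ : Finset (Fin 4)).map φ = Q := by
  let e : Fin 4 ≃ {x // x ∈ Q} := (Fintype.equivFinOfCardEq (by rw [Fintype.card_coe, hQ])).symm
  refine ⟨e.toEmbedding.trans (Function.Embedding.subtype _), ?_⟩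
  ext x
  simp only [mem_map, mem_univ, true_and, Function.Embedding.trans_apply, Equiv.coe_toEmbedding, Function.Embedding.coe_subtype]
  constructor
  · rintro ⟨i, rfl⟩; exact (e i).2
  · intro hx; exact ⟨e.symm ⟨x, hx⟩, by simp⟩

/-- Transport of the localised small pairs (division form) along an injection `φ : Fin 4 ↪ α`. [this work] -/
theorem localPairs_map_div {α : Type*} [DecidableEq α] [Fintype α] (φ : Fin 4 ↪ α) (F G : Finset (Finset α)) (k : ℕ) :
    ∑ P ∈ ((univ : Finset (Fin 4)).map φ).powerset, ∑ P' ∈ ((univ : Finset (Fin 4)).map φ).powerset,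
        (ιq (smallXo F G) P * ιq (smallZo F G) P' * (if Disjoint P P' then 1 else 0) / (((k - #(P ∪ P')).choose (4 - #(P ∪ P')) : ℕ) : ℚ)
          - ιq (smallN F G) P * ιq (smallY F G) P' * (if Disjoint P P' then 1 else 0) / (((k - #(P ∪ P')).choose (4 - #(P ∪ P')) : ℕ) : ℚ)) =
      ∑ P ∈ (univ : Finset (Fin 4)).powerset, ∑ P' ∈ (univ : Finset (Fin 4)).powerset,
        (ιq (smallXo ((univ : Finset (Fin 4)).powerset.filter fun T => T.map φ ∈ F) ((univ : Finset (Fin 4)).powerset.filter fun T => T.map φ ∈ G)) P *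
            ιq (smallZo ((univ : Finset (Fin 4)).powerset.filter fun T => T.map φ ∈ F) ((univ : Finset (Fin 4)).powerset.filter fun T => T.map φ ∈ G)) P' *
            (if Disjoint P P' then 1 else 0) / (((k - #(P ∪ P')).choose (4 - #(P ∪ P')) : ℕ) : ℚ)
          - ιq (smallN ((univ : Finset (Fin 4)).powerset.filter fun T => T.map φ ∈ F) ((univ : Finset (Fin 4)).powerset.filter fun T => T.map φ ∈ G)) P *
            ιq (smallY ((univ : Finset (Fin 4)).powerset.filter fun T => T.map φ ∈ F) ((univ : Finset (Fin 4)).powerset.filter fun T => T.map φ ∈ G)) P' *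
            (if Disjoint P P' then 1 else 0) / (((k - #(P ∪ P')).choose (4 - #(P ∪ P')) : ℕ) : ℚ)) := by
  have h := localPairs_map φ F G (fun m => ((((k - m).choose (4 - m)) : ℕ) : ℚ)⁻¹)
  simp only [div_eq_mul_inv]
  exact h

/-- The pull-back of a loop-free up-set along `φ : Fin 4 ↪ α` (no `∅`, no singleton `{φ i}`) is a member of `ups`. [this work] -/
theorem pullback_mem_ups {α : Type*} [DecidableEq α] {F : Finset (Finset α)} (hF : IsUpperSet (F : Set (Finset α))) (φ : Fin 4 ↪ α)
    (h0 : ∅ ∉ F) (h1 : ∀ i : Fin 4, ({φ i} : Finset α) ∉ F) :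
    ((univ : Finset (Fin 4)).powerset.filter fun T => T.map φ ∈ F) ∈ ups := by
  refine mem_ups (fun S hS => ?_) (fun S hS T hST => ?_)
  · have hSF : S.map φ ∈ F := (mem_filter.1 hS).2
    by_contra hlt
    rcases Nat.lt_or_ge #S 1 with h0' | h1'
    · have hS0 : S = ∅ := card_eq_zero.1 (by omega)
      rw [hS0, map_empty] at hSF
      exact h0 hSF
    · obtain ⟨i, hi⟩ := card_eq_one.1 (show #S = 1 by omega)
      rw [hi, map_singleton] at hSF
      exact h1 i hSF
  · exact mem_filter.2 ⟨mem_powerset.2 (subset_univ _), hF (map_subset_map.2 hST) (mem_filter.1 hS).2⟩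

/-- **ROW 0 OF `R_3 ∈ ℕ[s]` FOR EVERY NUMBER OF POINTS**: for a pair of up-sets `𝒳, 𝒵` and a loop-free `V` (no `∅`, no singleton of `V`
in either family), `[s^V] R_3(𝒳,𝒵) ≥ 0`.  `#V ≤ 9`: `…RtThreeCertNine`; `#V ≥ 10`: Kleitman bulk + the four-point window certificate
(`coeff_ind_Rt_three_nonneg_of_local` + `loc_nonneg_fin4` on every 4-subset). [this work] -/
theorem coeff_ind_Rt_three_nonneg {α : Type*} [DecidableEq α] [Fintype α] {F G : Finset (Finset α)}
    (hF : IsUpperSet (F : Set (Finset α))) (hG : IsUpperSet (G : Set (Finset α))) (V : Finset α) (h0F : ∅ ∉ F) (h0G : ∅ ∉ G)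
    (h1F : ∀ v ∈ V, ({v} : Finset α) ∉ F) (h1G : ∀ v ∈ V, ({v} : Finset α) ∉ G) : 0 ≤ (Rt 3 F G).coeff (ind V) := by
  by_cases h9 : #V ≤ 9
  · exact coeff_ind_Rt_three_nonneg_of_card_le_nine hF hG V h9 h0F h0G h1F h1G
  refine coeff_ind_Rt_three_nonneg_of_local hF hG V (by omega) fun Q hQ => ?_
  obtain ⟨hQV, hQ4⟩ := mem_powersetCard.1 hQ
  obtain ⟨φ, rfl⟩ := exists_map_univ_eq Q hQ4
  have hφV : ∀ i : Fin 4, φ i ∈ V := fun i => hQV (mem_map_of_mem φ (mem_univ i))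
  rw [atomSum_map, localPairs_map_div]
  exact loc_nonneg_fin4 (#V) (by omega) _ _ (pullback_mem_ups hF φ h0F fun i => h1F _ (hφV i))
    (pullback_mem_ups hG φ h0G fun i => h1G _ (hφV i))

end RtThreeFin4

namespace RtThreeFin4

open SahiCTCGenFun MvPolynomial

/-- `R_3(2^α, 𝒵) = 0`: with every set in `𝒳`, `X = Π`, `Y₃ = Z₃`, `X₂ = Θ₂` and `R_3 = Θ₂Π(Z₃ + Z_{<3} − Z) = 0`. [this work] -/
theorem Rt_three_univ_powerset_left {α : Type*} [DecidableEq α] [Fintype α] (G : Finset (Finset α)) :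
    Rt 3 (univ.powerset : Finset (Finset α)) G = 0 := by
  unfold Rt
  have h1 : (univ.powerset : Finset (Finset α)) ∩ G = G := inter_eq_right.2 fun S _ => mem_powerset.2 (subset_univ S)
  have h2 : below 3 (univ.powerset : Finset (Finset α)) = bySize (· < 3) := rfl
  have h3 : gf (univ.powerset : Finset (Finset α)) = PiP := rfl
  rw [h1, h2, h3, gf_eq_atLeast_add_below 3 G]
  ring

/-- `R_3(𝒳, 2^α) = 0`, symmetrically. [this work] -/
theorem Rt_three_univ_powerset_right {α : Type*} [DecidableEq α] [Fintype α] (F : Finset (Finset α)) :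
    Rt 3 F (univ.powerset : Finset (Finset α)) = 0 := by
  unfold Rt
  have h1 : F ∩ (univ.powerset : Finset (Finset α)) = F := inter_eq_left.2 fun S _ => mem_powerset.2 (subset_univ S)
  have h2 : below 3 (univ.powerset : Finset (Finset α)) = bySize (· < 3) := rfl
  have h3 : gf (univ.powerset : Finset (Finset α)) = PiP := rfl
  rw [h1, h2, h3, gf_eq_atLeast_add_below 3 F]
  ring

/-- **ROW 0 IN PROFILE FORM** (the `#dbl = 0` case of the open core `hLF` of `coeff_Rt_three_nonneg_of_loopFree'`): for up-sets `𝒳, 𝒵` and a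
profile `n` with all entries `≤ 1` whose points are loop-free in both families, `coeff_n R_3(𝒳,𝒵) ≥ 0` (if `∅` is a member, that family is
`2^α` and `R_3 = 0`). [this work] -/
theorem coeff_Rt_three_nonneg_of_le_one {α : Type*} [DecidableEq α] [Fintype α] {F G : Finset (Finset α)}
    (hF : IsUpperSet (F : Set (Finset α))) (hG : IsUpperSet (G : Set (Finset α))) (n : α →₀ ℕ) (hn : ∀ i, n i ≤ 1)
    (hl : ∀ u, n u = 1 → ({u} : Finset α) ∉ F ∧ ({u} : Finset α) ∉ G) : 0 ≤ (Rt 3 F G).coeff n := by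
  by_cases h0F : ∅ ∈ F
  · rw [eq_univ_powerset_of_empty_mem hF h0F, Rt_three_univ_powerset_left, coeff_zero]
  by_cases h0G : ∅ ∈ G
  · rw [eq_univ_powerset_of_empty_mem hG h0G, Rt_three_univ_powerset_right, coeff_zero]
  have h1 : ∀ v ∈ n.support, n v = 1 := fun v hv => by
    have := Finsupp.mem_support_iff.1 hv; have := hn v; omega
  have hnV : n = ind n.support := by
    ext i
    rw [ind_apply]
    by_cases hi : i ∈ n.support
    · rw [if_pos hi, h1 i hi]
    · rw [if_neg hi]; exact Finsupp.notMem_support_iff.1 hi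
  rw [hnV]
  exact coeff_ind_Rt_three_nonneg hF hG n.support h0F h0G (fun v hv => (hl v (h1 v hv)).1) (fun v hv => (hl v (h1 v hv)).2)

/-- **ROW 0 IN THE SHAPE OF `hLF`**: entries `≤ 2`, no doubled point, single points loop-free ⇒ `coeff_n R_3 ≥ 0`. [this work] -/
theorem coeff_Rt_three_nonneg_of_card_dbl_eq_zero {α : Type*} [DecidableEq α] [Fintype α] {F G : Finset (Finset α)}
    (hF : IsUpperSet (F : Set (Finset α))) (hG : IsUpperSet (G : Set (Finset α))) (n : α →₀ ℕ) (hn : ∀ i, n i ≤ 2) (hd : #(dbl n) = 0)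
    (hl : ∀ u, n u = 1 → ({u} : Finset α) ∉ F ∧ ({u} : Finset α) ∉ G) : 0 ≤ (Rt 3 F G).coeff n := by
  refine coeff_Rt_three_nonneg_of_le_one hF hG n (fun i => ?_) hl
  have h2 : n i ≠ 2 := fun h => by
    have : i ∈ dbl n := by
      unfold dbl; exact mem_filter.2 ⟨Finsupp.mem_support_iff.2 (by rw [h]; norm_num), h⟩
    rw [card_eq_zero.1 hd] at this
    exact notMem_empty _ this
  have := hn i
  omega

end RtThreeFin4

end Summit.CriticalPhenomena.PercolationContinuityZ3.Theorems.SahiCTCForms
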